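import Literature.IUT.HodgeTheaters.FrobenioidBridgeEx54ivInfKappaReconData
import Literature.IUT.HodgeTheaters.InitialThetaDataAbsoluteGaloisMoves
import HarnessLib

/-!
# [IUTchI] Example 5.4 (iv), p. 149 / Example 5.1 (i), p. 124: the non-vacuity lemmas of the reconstruction
# presentation with the hypothesis "`G_F` moves a constant of `F̄`" DISCHARGED (GAP B = G-L5t9g8-1; GB-07 add-on)

S. Mochizuki, *Inter-universal Teichmüller theory I*, kurims manuscript (May 2020), Example 5.1 (i) p. 124
(«by applying the functorial algorithm of [AbsTopIII] Thm 1.9 … one obtains a `π₁`-equivariant reconstruction of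
the function field»), Example 5.4 (iv) p. 149 [claim: Mochizuki2012, status: disputed].

WHAT THIS FILE DOES (abc-iut cell, GAP B `G-L5t9g8-1`, chair's RULINGS #354 (ii) «`hcoeff` dischargeable from
`NumberField F`»).  The non-vacuity ("NV") lemmas of the C2 lane —
`InitialThetaData.not_exists_reconEquivariantFor_of_act_eq_refl` (GB-14, `FrobenioidBridgeEx54ivInfKappaRecon.lean`:
a reconstruction datum whose `Π_{C_F}`-action on `K_A` is trivial is equivariantly comparable to `F̄(t)` for NO
comparison) and `InitialThetaData.C2Residuals'.exists_act_ne_refl` (GB-18,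
`FrobenioidBridgeEx54ivInfKappaReconData.lean`: under `hEq` at THE comparison the action is NOT trivial) — carry the
free hypothesis `(hcoeff : ∃ (σ : Fbar ≃ₐ[F] Fbar) (c : Fbar), σ c ≠ c)`.  That hypothesis is a THEOREM at any initial
Θ-datum (`InitialThetaData.exists_galois_apply_ne`, `InitialThetaDataAbsoluteGaloisMoves.lean`: a number field is not
algebraically closed and `F̄^{G_F} = F`), so here the same lemmas are restated WITHOUT it (primed names), together with
the two one-step consequences for the residual records of record: `C2Residuals` (GB-14) and `C2Residuals'` (GB-18)
force `R.act g ≠ 1` for some `g ∈ Π_{C_F}` — i.e. they constrain the ALGORITHM `R.alg` (its transport along inner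
automorphisms of `Π_{C_F}`), not only the comparison isomorphism.

HONEST LABEL: elementary consequences of landed lemmas at OUR typed objects; the residual records remain HYPOTHESES
asserted by nobody; nothing here inhabits `hEq`, asserts [AbsTopIII] Thm 1.9, or takes a side on [IUTchIII]
Cor. 3.12; abc is not proved; no `instance`, no notation.
-/

namespace Literature.IUT.HodgeTheaters

open Literature.AnabelianGeometry.AbsoluteAnabelian
open Literature.AnabelianGeometry.AbsoluteAnabelian.AbsTopIII
open Literature.FieldTheory.FunctionField

universe u

namespace InitialThetaData

variable {F K Fbar : Type u} [Field F] [NumberField F] [Field K] [NumberField K] [Algebra F K]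
  [Field Fbar] [Algebra F Fbar] [Algebra K Fbar] {E : WeierstrassCurve F} [E.IsElliptic] {l : ℕ}
  {Pb : BadPlacePredicates K} {D : InitialThetaData F K Fbar E l Pb}

/-! ### GB-14's NV lemma, unconditionally -/

/-- **A reconstruction datum with TRIVIAL `Π_{C_F}`-action on `K_A` is `G_F`-equivariantly comparable to `F̄(t)` for
NO comparison `φ`** — `not_exists_reconEquivariantFor_of_act_eq_refl` with its hypothesis `hcoeff` DISCHARGED by
`D.exists_galois_apply_ne` (`G_F` moves a constant of `F̄` at every initial Θ-datum). ([IUTchI] Ex 5.1 (i) p.124)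
[claim: Mochizuki2012, status: disputed] -/
theorem not_exists_reconEquivariantFor_of_act_eq_refl' {R : D.ReconRatObjects}
    (hact : ∀ g : D.geom.extF.arith, R.act g = RingEquiv.refl R.funField) :
    ¬ ∃ φ, D.ReconEquivariantFor R φ :=
  not_exists_reconEquivariantFor_of_act_eq_refl hact D.exists_galois_apply_ne

/-- **An equivariant comparison forces a non-trivial action**: if `φ : K_A ≃+* F̄(t)` is `Π_{C_F}`/`G_F`-equivariant
(`D.ReconEquivariantFor R φ`), then `R.act g ≠ 1` for some `g ∈ Π_{C_F}` — the algorithm `R.alg` transports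
NON-trivially along some inner automorphism of `Π_{C_F}`. ([IUTchI] Ex 5.1 (i) p.124) [claim: Mochizuki2012, status: disputed] -/
theorem ReconEquivariantFor.exists_act_ne_refl {R : D.ReconRatObjects} {φ : R.funField ≃+* RatFunc Fbar}
    (hφ : D.ReconEquivariantFor R φ) : ∃ g : D.geom.extF.arith, R.act g ≠ RingEquiv.refl R.funField := by
  by_contra h
  push Not at h
  exact not_exists_reconEquivariantFor_of_act_eq_refl' h ⟨φ, hφ⟩

/-- Pointwise form: under an equivariant `φ`, some `g ∈ Π_{C_F}` and some `x ∈ K_A` have `g · x ≠ x`.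
([IUTchI] Ex 5.1 (i) p.124) [claim: Mochizuki2012, status: disputed] -/
theorem ReconEquivariantFor.exists_act_apply_ne {R : D.ReconRatObjects} {φ : R.funField ≃+* RatFunc Fbar}
    (hφ : D.ReconEquivariantFor R φ) : ∃ (g : D.geom.extF.arith) (x : R.funField), R.act g x ≠ x := by
  obtain ⟨g, hg⟩ := hφ.exists_act_ne_refl
  by_contra h
  push Not at h
  exact hg (RingEquiv.ext (h g))

/-! ### The residual records of record force a non-trivial action -/

/-- **GB-14's record `C2Residuals G R` forces `R.act ≠ 1`**: its field `hEq : ∃ φ, D.ReconEquivariantFor R φ`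
constrains the algorithm `R.alg`, unconditionally (no `hcoeff`). ([IUTchI] Ex 5.4 (iv) p.149) [claim: Mochizuki2012, status: disputed] -/
theorem C2Residuals.exists_act_ne_refl {G : D.LocalThetaGeometry} {R : D.ReconRatObjects} (ρ : D.C2Residuals G R) :
    ∃ g : D.geom.extF.arith, R.act g ≠ RingEquiv.refl R.funField := by
  obtain ⟨φ, hφ⟩ := ρ.hEq
  exact hφ.exists_act_ne_refl

/-- **GB-18's record `C2Residuals' G R` forces `R.act ≠ 1`** — `C2Residuals'.exists_act_ne_refl` with `hcoeff`
DISCHARGED. ([IUTchI] Ex 5.4 (iv) p.149) [claim: Mochizuki2012, status: disputed] -/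
theorem C2Residuals'.exists_act_ne_refl' {G : D.LocalThetaGeometry} {R : D.ReconRatObjects'}
    (ρ : D.C2Residuals' G R) : ∃ g : D.geom.extF.arith, R.act g ≠ RingEquiv.refl R.funField :=
  ρ.exists_act_ne_refl D.exists_galois_apply_ne

/-- The arch-extended record `C2ResidualsArch' G R` likewise forces `R.act ≠ 1`. ([IUTchI] Ex 5.4 (iv) p.149)
[claim: Mochizuki2012, status: disputed] -/
theorem C2ResidualsArch'.exists_act_ne_refl {G : D.LocalThetaGeometry} {R : D.ReconRatObjects'}
    (ρ : D.C2ResidualsArch' G R) : ∃ g : D.geom.extF.arith, R.act g ≠ RingEquiv.refl R.funField :=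
  ρ.toC2Residuals'.exists_act_ne_refl'

/-- Contrapositive, as a test on candidate reconstruction data: a datum-with-`φ` whose algorithm transports
trivially along every inner automorphism of `Π_{C_F}` satisfies the residual record `C2Residuals' G R` for NO
local Θ-geometry `G` (its `hEq` fails). ([IUTchI] Ex 5.4 (iv) p.149) [claim: Mochizuki2012, status: disputed] -/
theorem not_c2Residuals'_of_act_eq_refl {G : D.LocalThetaGeometry} {R : D.ReconRatObjects'}
    (hact : ∀ g : D.geom.extF.arith, R.act g = RingEquiv.refl R.funField) : ¬ D.C2Residuals' G R :=
  fun ρ => by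
    obtain ⟨g, hg⟩ := ρ.exists_act_ne_refl'
    exact hg (hact g)

end InitialThetaData
end Literature.IUT.HodgeTheaters
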